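import Literature.Probability.LatticeModels.SquareTilingModulusProofs
import Literature.Probability.Percolation.BoxCrossingProofs
import Literature.Barriers.CriticalPhenomena.SupercriticalSAWSpaceFillingNarrow

/-!
# A uniform bound for the effective conductance between the discrete arcs of `Ω_δ ⊆ δℤ²`
# ([GP19] Lemma 4.4 for the `meshDomain` / `discreteArc` discretisation)

Support file for `KirchhoffExtremalLength` (route CardyUSTContinuation of `CardyFormulaZ2`, item
stmt-CriticalPhenomena-11234): the first a-priori estimate needed by any proof of the residual
statement `G02ModulusConvergence` (`…Defs.lean`). For a bounded open `Ω ⊆ B̄(0, r)`, sets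
`A, B ⊆ ℂ` at distance `≥ ε`, and a mesh `0 < δ ≤ r` with `4δ ≤ ε`, the unit-conductance
effective conductance of `discreteDomainGraph Ω δ` between the discrete arcs
`discreteArc Ω δ A` and `discreteArc Ω δ B` is at most `200 r² / ε²`
(`effectiveConductance_discreteArc_le`); for a conformal rectangle and the arcs `(ab)`, `(cd)`
the conductances are bounded eventually in `δ → 0⁺` (`eventually_effectiveConductance_discreteArc_le`).
The proof is that of the tree's `SquareTiling.effectiveConductance_arcVertices_le` ([GP19],
Lemma 4.4: Duffin's discrete extremal length with unit edge lengths — paths from `A_δ` to `B_δ`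
have `≥ (ε - 2δ)/δ` edges, `Ω_δ` has `≤ 50 r²/δ²` edges, the vertex count being the tree's
`SupercriticalSAW.ncard_meshDomain_le`), transposed to this discretisation
(vertices of a discrete arc are within `δ` of the arc, `infDist_le_of_mem_discreteArc`).
-/

noncomputable section

namespace Summit.CriticalPhenomena.CardyFormulaZ2.Theorems

namespace KirchhoffSlope

open Set Metric Filter Topology
open scoped ENNReal NNReal
open Literature.Probability.LatticeModels Literature.Probability.Percolation
open Literature.Probability.LatticeModels.SquareTiling (walkLength_one networkArea_one_one exists_eq_mk_add_single)

variable {Ω : Set ℂ} {δ : ℝ}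

/-- Along a walk of `Ω_δ` the mesh points move by `|δ|` per edge. [folklore] -/
theorem dist_le_mul_length_discreteDomainGraph {x y : Site 2} (p : (discreteDomainGraph Ω δ).Walk x y) :
    dist (meshPoint δ x) (meshPoint δ y) ≤ |δ| * p.length := by
  induction p with
  | nil => simp
  | @cons a b c hab q ih =>
    have hab' : (zdGraph 2).Adj a b :=
      meshGraph_le_zdGraph Ω δ (discreteDomainGraph_le_meshGraph Ω δ hab)
    calc dist (meshPoint δ a) (meshPoint δ c)
        ≤ dist (meshPoint δ a) (meshPoint δ b) + dist (meshPoint δ b) (meshPoint δ c) := dist_triangle _ _ _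
      _ ≤ |δ| + |δ| * q.length := by rw [dist_meshPoint_of_adj hab']; exact add_le_add_right ih _
      _ = |δ| * (SimpleGraph.Walk.cons hab q).length := by
          rw [SimpleGraph.Walk.length_cons]; push_cast; ring

/-- A vertex of the discrete arc of a nonempty compact `A ⊆ ∂Ω` (`Ω` open) lies within `|δ|` of a
point of `A`. [folklore] -/
theorem exists_dist_le_of_mem_discreteArc (hΩ : IsOpen Ω) {A : Set ℂ} (hA : IsCompact A)
    (hAne : A.Nonempty) {x : Site 2} (hx : x ∈ discreteArc Ω δ A) :
    ∃ a ∈ A, dist (meshPoint δ x) a ≤ |δ| := by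
  obtain ⟨a, ha, hda⟩ := hA.exists_infDist_eq_dist hAne (meshPoint δ x)
  exact ⟨a, ha, hda ▸ infDist_le_of_mem_discreteArc hΩ hx⟩

/-- **Paths between the discrete arcs are long**: if `A` and `B` are at distance `≥ ε`, every
walk of `Ω_δ` from `A_δ` to `B_δ` has at least `(ε - 2δ)/δ` edges. [folklore] -/
theorem sub_le_mul_length_discreteArc (hΩ : IsOpen Ω) {A B : Set ℂ} (hA : IsCompact A)
    (hAne : A.Nonempty) (hB : IsCompact B) (hBne : B.Nonempty) {ε : ℝ}
    (hε : ∀ a ∈ A, ∀ b ∈ B, ε ≤ dist a b) (hδ : 0 < δ) {x y : Site 2}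
    (hx : x ∈ discreteArc Ω δ A) (hy : y ∈ discreteArc Ω δ B) (p : (discreteDomainGraph Ω δ).Walk x y) :
    ε - 2 * δ ≤ δ * p.length := by
  obtain ⟨a, haA, ha⟩ := exists_dist_le_of_mem_discreteArc hΩ hA hAne hx
  obtain ⟨b, hbB, hb⟩ := exists_dist_le_of_mem_discreteArc hΩ hB hBne hy
  rw [abs_of_pos hδ] at ha hb
  have hp := dist_le_mul_length_discreteDomainGraph p
  rw [abs_of_pos hδ] at hp
  have := hε a haA b hbB
  have htri : dist a b ≤ dist a (meshPoint δ x) + dist (meshPoint δ x) (meshPoint δ y) +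
      dist (meshPoint δ y) b := dist_triangle4 _ _ _ _
  rw [_root_.dist_comm] at ha
  linarith

/-- The edges of `Ω_δ` are among the `s(z, z + eᵢ)`, `z ∈ meshDomain Ω δ`, `i : Fin 2`. [folklore] -/
theorem edgeSet_discreteDomainGraph_subset_image :
    (discreteDomainGraph Ω δ).edgeSet ⊆
      (fun p : Site 2 × Fin 2 => s(p.1, p.1 + Pi.single p.2 1)) '' (meshDomain Ω δ ×ˢ univ) := by
  refine Sym2.ind (fun x y hxy => ?_)
  rw [SimpleGraph.mem_edgeSet] at hxy
  obtain ⟨hm, hx, hy⟩ := discreteDomainGraph_adj_iff.1 hxy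
  obtain ⟨z, i, hz, he⟩ := exists_eq_mk_add_single (meshGraph_le_zdGraph Ω δ hm)
  refine ⟨(z, i), ⟨?_, mem_univ _⟩, he.symm⟩
  rcases hz with rfl | rfl
  · exact hx
  · exact hy

/-- For bounded `Ω` and `δ > 0`, `Ω_δ` has finitely many edges. [folklore] -/
theorem edgeSet_discreteDomainGraph_finite (hΩ : Bornology.IsBounded Ω) (hδ : 0 < δ) :
    (discreteDomainGraph Ω δ).edgeSet.Finite :=
  (((meshDomain_finite hΩ hδ).prod finite_univ).image _).subset edgeSet_discreteDomainGraph_subset_image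

/-- `Ω_δ` has at most twice as many edges as vertices. [folklore] -/
theorem ncard_edgeSet_discreteDomainGraph_le (hΩ : Bornology.IsBounded Ω) (hδ : 0 < δ) :
    (discreteDomainGraph Ω δ).edgeSet.ncard ≤ 2 * (meshDomain Ω δ).ncard := by
  have hfin : (meshDomain Ω δ ×ˢ (univ : Set (Fin 2))).Finite := (meshDomain_finite hΩ hδ).prod finite_univ
  calc (discreteDomainGraph Ω δ).edgeSet.ncard
      ≤ ((fun p : Site 2 × Fin 2 => s(p.1, p.1 + Pi.single p.2 1)) '' (meshDomain Ω δ ×ˢ univ)).ncard :=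
        ncard_le_ncard edgeSet_discreteDomainGraph_subset_image (hfin.image _)
    _ ≤ (meshDomain Ω δ ×ˢ (univ : Set (Fin 2))).ncard := ncard_image_le hfin
    _ = 2 * (meshDomain Ω δ).ncard := by
        rw [ncard_prod, ncard_univ, Nat.card_eq_fintype_card, Fintype.card_fin, mul_comm]

/-- **[GP19] Lemma 4.4 for the `meshDomain`/`discreteArc` discretisation** (uniform bound on the
effective conductance between the discrete arcs): if `Ω ⊆ B̄(0, r)` is open and bounded, `A`, `B`
are nonempty compact sets with `dist(A, B) ≥ ε`, `0 < δ ≤ r` and `4δ ≤ ε`, then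
`𝒞(A_δ ↔ B_δ; Ω_δ) ≤ 200 r² / ε²` (unit conductances). Duffin's discrete extremal length with
unit edge lengths, exactly as in the tree's `SquareTiling.effectiveConductance_arcVertices_le`.
[cite: GeorgakopoulosPanagiotis2019, Lemma 4.4] -/
theorem effectiveConductance_discreteArc_le {r ε : ℝ} (hΩr : Ω ⊆ closedBall 0 r) (hΩo : IsOpen Ω)
    (hΩb : Bornology.IsBounded Ω) {A B : Set ℂ} (hA : IsCompact A) (hAne : A.Nonempty)
    (hB : IsCompact B) (hBne : B.Nonempty) (hε : ∀ a ∈ A, ∀ b ∈ B, ε ≤ dist a b)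
    (hδ : 0 < δ) (hδr : δ ≤ r) (hδε : 4 * δ ≤ ε) :
    effectiveConductance (discreteDomainGraph Ω δ) 1 (discreteArc Ω δ A) (discreteArc Ω δ B) ≤
      ENNReal.ofReal (200 * r ^ 2 / ε ^ 2) := by
  have hr : 0 < r := hδ.trans_le hδr
  have hε0 : 0 < ε := by linarith
  set G := discreteDomainGraph Ω δ
  set W : Sym2 (Site 2) → ℝ≥0 := fun _ => 1 with hW
  have hduff := effectiveConductance_mul_edgeDist_sq_le G 1 (discreteArc Ω δ A) (discreteArc Ω δ B) W
  -- the distance is at least `ε / (2δ)`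
  have hdist : ENNReal.ofReal (ε / (2 * δ)) ≤ edgeDist G W (discreteArc Ω δ A) (discreteArc Ω δ B) := by
    refine le_trans (b := ENNReal.ofReal ((ε - 2 * δ) / δ)) (ENNReal.ofReal_le_ofReal ?_)
      (le_edgeDist fun x hx y hy p => ?_)
    · rw [div_le_div_iff₀ (by positivity) hδ]
      nlinarith
    · rw [walkLength_one, ENNReal.coe_natCast]
      have h := sub_le_mul_length_discreteArc hΩo hA hAne hB hBne hε hδ hx hy p
      have h' : (ε - 2 * δ) / δ ≤ p.length := by rw [div_le_iff₀ hδ]; linarith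
      calc ENNReal.ofReal ((ε - 2 * δ) / δ) ≤ ENNReal.ofReal (p.length : ℝ) := ENNReal.ofReal_le_ofReal h'
        _ = (p.length : ℝ≥0∞) := by rw [ENNReal.ofReal_natCast]
  -- the area is the number of edges, at most `50 r² / δ²`
  have hfin := edgeSet_discreteDomainGraph_finite (Ω := Ω) hΩb hδ
  have harea : networkArea G 1 W ≤ ENNReal.ofReal (50 * r ^ 2 / δ ^ 2) := by
    rw [hW, networkArea_one_one G hfin]
    have h1 := ncard_edgeSet_discreteDomainGraph_le (Ω := Ω) hΩb hδ
    have h2 := Literature.Barriers.CriticalPhenomena.SupercriticalSAW.ncard_meshDomain_le hΩr hδ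
    have hceil : (⌈r / δ⌉₊ : ℝ) ≤ r / δ + 1 := (Nat.ceil_lt_add_one (by positivity)).le
    have hrd : 1 ≤ r / δ := by rwa [le_div_iff₀ hδ, one_mul]
    have hbound : ((2 * ⌈r / δ⌉₊ + 1) ^ 2 : ℕ) ≤ (25 * (r / δ) ^ 2 : ℝ) := by
      push_cast
      nlinarith
    have hE : (G.edgeSet.ncard : ℝ) ≤ 50 * r ^ 2 / δ ^ 2 := by
      calc (G.edgeSet.ncard : ℝ) ≤ 2 * ((meshDomain Ω δ).ncard : ℝ) := by exact_mod_cast h1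
        _ ≤ 2 * ((2 * ⌈r / δ⌉₊ + 1) ^ 2 : ℕ) := by gcongr
        _ ≤ 2 * (25 * (r / δ) ^ 2) := by linarith
        _ = 50 * r ^ 2 / δ ^ 2 := by rw [div_pow]; ring
    calc (G.edgeSet.ncard : ℝ≥0∞) = ENNReal.ofReal (G.edgeSet.ncard : ℝ) := by rw [ENNReal.ofReal_natCast]
      _ ≤ ENNReal.ofReal (50 * r ^ 2 / δ ^ 2) := ENNReal.ofReal_le_ofReal hE
  -- combine
  have hd0 : ENNReal.ofReal (ε / (2 * δ)) ≠ 0 := by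
    rw [ne_eq, ENNReal.ofReal_eq_zero, not_le]; positivity
  have key : effectiveConductance G 1 (discreteArc Ω δ A) (discreteArc Ω δ B) *
      ENNReal.ofReal (ε / (2 * δ)) ^ 2 ≤ ENNReal.ofReal (50 * r ^ 2 / δ ^ 2) :=
    le_trans (by gcongr) (hduff.trans harea)
  rw [← ENNReal.le_div_iff_mul_le (Or.inl (pow_ne_zero 2 hd0)) (Or.inl (by simp))] at key
  refine key.trans (le_of_eq ?_)
  rw [← ENNReal.ofReal_pow (by positivity), ← ENNReal.ofReal_div_of_pos (by positivity)]
  congr 1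
  field_simp
  ring

/-- **Uniform bound for a conformal rectangle** along all meshes: there is a finite `K` such that
for all sufficiently small `δ > 0` the effective conductance of `Ω_δ` between the discrete arcs
of `(ab)` and `(cd)` is at most `K`. [cite: GeorgakopoulosPanagiotis2019, Lemma 4.4] -/
theorem eventually_effectiveConductance_discreteArc_le
    (R : Literature.Probability.RandomPlanarGeometry.ConformalRectangle) :
    ∃ K : ℝ≥0, ∀ᶠ δ : ℝ in 𝓝[>] 0,
      effectiveConductance (discreteDomainGraph R.carrier δ) 1
          (discreteArc R.carrier δ (R.arc 0)) (discreteArc R.carrier δ (R.arc 2)) ≤ K := by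
  obtain ⟨ε, hε, hεd⟩ := R.exists_pos_forall_lt_dist_arc
  obtain ⟨r₀, hr₀⟩ := (isBounded_iff_subset_closedBall (0 : ℂ)).1 R.isBounded
  set r := max r₀ 1 with hr
  have hΩ : R.carrier ⊆ closedBall 0 r := hr₀.trans (closedBall_subset_closedBall (le_max_left _ _))
  have hr1 : 1 ≤ r := le_max_right _ _
  have hK0 : (0 : ℝ) ≤ 200 * r ^ 2 / ε ^ 2 := by positivity
  refine ⟨⟨200 * r ^ 2 / ε ^ 2, hK0⟩, ?_⟩
  have hpos : 0 < min r (ε / 4) := lt_min (by linarith) (by linarith)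
  filter_upwards [Ioo_mem_nhdsGT hpos] with δ hδ
  refine (effectiveConductance_discreteArc_le hΩ R.isOpen R.isBounded (R.isCompact_arc 0)
    ⟨_, R.pt_mem_arc_self 0⟩ (R.isCompact_arc 2) ⟨_, R.pt_mem_arc_self 2⟩
    (fun a ha b hb => (hεd a ha b hb).le) hδ.1 (hδ.2.le.trans (min_le_left _ _)) ?_).trans (le_of_eq ?_)
  · linarith [hδ.2.le.trans (min_le_right r (ε / 4))]
  · exact ENNReal.ofReal_eq_coe_nnreal hK0

end KirchhoffSlope

end Summit.CriticalPhenomena.CardyFormulaZ2.Theorems
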